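import Summits.HubbardSuperconductivity.HubbardSuperconductivity.Theorems.AnisotropyChordTransferFibre3Hole2L32a
import Summits.HubbardSuperconductivity.HubbardSuperconductivity.Theorems.AnisotropyChordTransferFibre3Hole2L32b
import Summits.HubbardSuperconductivity.HubbardSuperconductivity.Theorems.AnisotropyChordTransferFibre3Hole2L32c
import Summits.HubbardSuperconductivity.HubbardSuperconductivity.Theorems.AnisotropyChordTransferFibre3Hole2L32d
import Summits.HubbardSuperconductivity.HubbardSuperconductivity.Theorems.AnisotropyChordTransferFibre3Hole2Cover

/-!
# Route `AnisotropyChord` / H0 rotor rung: ★ HOLE₂(.75) AT `L = 32` — `TwoHoleGap 32 (3/4·eps1 32)`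

The one-body spectral input of the GM₃ assembly `gm3_of_hole2` (p1 g23) at side length `L = 32`: the Neumann gap of the rate-½ walk
on the `32 × 32` torus with ANY two vertices deleted is at least `¾ε₁(32)`.  Assembly of the kernel facts `checkRepsQ_32a…`
(`…Hole2L32a…`, 4 part(s), the 152 `D₄`-classes `repList 32` = `0 ≤ y ≤ x ≤ 16`) via `checkRepsQ_append`, the identification of
the parts with `repList 32` (`decide`), and `Hole2.twoHoleGap_of_checkRepsQ_repList` (`…Fibre3Hole2Cover`: `D₄`-coverage for every `L`;
soundness `…Fibre3Hole2Quarter`, p2's PROP BS, p1's reductions).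
Prover seat `hubbard-h0-rotor-p3` g3; helper for stmt-HubbardSuperconductivity-19089 (`--supports`, helper class).
WHAT THIS IS NOT: nothing here proves superconductivity in the Hubbard model (rotor TARGET as worded stays FALSE, g15 verdict); this
discharges, at ONE side length, ONE hypothesis (HOLE₂(.75)) of ONE conditional reduction (rung 19089). Tree imports only; no sorry.
-/

set_option linter.dupNamespace false
set_option autoImplicit false

namespace Summit.HubbardSuperconductivity.HubbardSuperconductivity.Theorems.AnisotropyChord.Transfer.Fibre3

namespace Hole2

/-- the kernel-fact parts list exactly `repList 32`. [folklore] -/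
theorem repList_32_eq : repList 32 = reps32a ++ reps32b ++ reps32c ++ reps32d := by
  decide +kernel

/-- every representative separation of the `32 × 32` torus passes the kernel check. [folklore] -/
theorem checkRepsQ_repList_32 : checkRepsQ 32 (repList 32) = true := by
  rw [repList_32_eq]
  exact checkRepsQ_append (checkRepsQ_append (checkRepsQ_append (checkRepsQ_32a) checkRepsQ_32b) checkRepsQ_32c) checkRepsQ_32d

/-- ★★★ HOLE₂(.75) AT `L = 32`: `TwoHoleGap 32 (3/4 * eps1 32)`, the spectral hypothesis of `gm3_of_hole2` at `L = 32`. [folklore] -/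
theorem twoHoleGap_thirtyTwo : TwoHoleGap 32 (3 / 4 * eps1 32) :=
  twoHoleGap_of_checkRepsQ_repList 32 checkRepsQ_repList_32

end Hole2

end Summit.HubbardSuperconductivity.HubbardSuperconductivity.Theorems.AnisotropyChord.Transfer.Fibre3
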